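import Literature.MathematicalPhysics.QuantumLattice.WightmanPermutedTubeLocal
import Literature.MathematicalPhysics.QuantumLattice.LocalTubeUniqueness
import HarnessLib

/-!
# One-sided Jost anchors: `W_σ = W` on the tube next to a real point whose permutation is a Jost point

Topic `Literature/MathematicalPhysics/QuantumLattice` (trunk T-AQFT), companion of
`WightmanPermutedTubeLocal` in the decomposition of the named fact
`IsWightmanQFT.extendedTube_continuation_perm_eq` ((K): consistency under permutations of the
Bargmann–Hall–Wightman continuation of the Wightman functions of one scalar field on
`𝒯'ₙ ∩ σ𝒯'ₙ`; Streater–Wightman (1964) Thm. 3-6, Osterwalder–Schrader I §5 p. 97).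

`WightmanPermutedTubeLocal.perm_eq_nhds_of_real` is Streater–Wightman's Thm. 3-6 as printed: near a
real configuration `x` such that **both** `x` and `x ∘ σ` are Jost points (real points of the
extended tube `𝒯'ₙ`), the continued function satisfies `𝔚(z ∘ σ) = 𝔚(z)` — two real-analytic
functions are compared on a real environment. Such two-sided points do not exist in `1 + 1`
dimensions for most `σ`, and in general dimension it is not known which components of `𝒯'ₙ ∩ σ𝒯'ₙ`
they reach. This file proves the **one-sided** version, in which only the permuted point is
required to be a Jost point and the comparison is made with the *boundary value* of `𝔚` from the
forward tube:

* `perm_eq_near_of_perm_real_mem` (**main result**): let `𝔚` be analytic on `𝒯'ₙ` with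
  distributional boundary value `T` from `𝒯ₙ`, `T` local (S–W (3-34) on compact supports). If
  `x ∘ σ` is a real point of `𝒯'ₙ`, then there is a neighbourhood `U` of `x` (complexified) with
  `𝔚(z ∘ σ) = 𝔚(z)` for all `z ∈ U ∩ 𝒯ₙ`.

Proof. Near `x` the function `z ↦ 𝔚(z ∘ σ)` is holomorphic (the extended tube is open), so on a
local tube `L = {x' + iy | x' ∈ B(x, r), y ∈ 𝒞ₙ, ‖y‖ < r}` (`𝒞ₙ` the base cone of `𝒯ₙ`) the difference
`D = 𝔚 − 𝔚(· ∘ σ)` is holomorphic. Its ray boundary values vanish: along `x' + itη`, `𝔚 → T`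
(hypothesis), while `𝔚((x' + itη) ∘ σ) → 𝔚(x' ∘ σ)` locally uniformly (continuity up to the real
points, dominated convergence: `tendsto_integral_rayC_mul_of_continuousOn`), and
`∫ 𝔚(x' ∘ σ) φ(x') dx' = T(φ ∘ σ) = T(φ)` — the first because at the Jost points `x' ∘ σ` the
distribution `T` *is* the function `𝔚` (`HasDistributionalBoundaryValue.eq_integral_of_continuousOn`,
change of variables), the second by local commutativity, all pairs of points of a Jost point being
space-like separated (`apply_permTest_eq_of_isLocal`). Hence `D = 0` on `L` by the uniqueness of
distributional boundary values on a local tube (Hörmander Thm. 3.1.15 / S–W Thm. 2-17,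
`eq_zero_on_localTube_of_rayBoundaryValue_zero`).

With the geometric supply of such one-sided anchors (`PermutedTubeRealAnchors`) this yields (K) in
every dimension (`WightmanPermutedTubeHolds`).

## References

* R. F. Streater, A. S. Wightman, *PCT, Spin and Statistics, and All That* (1964), Thm. 2-17,
  Thm. 3-2 (d) eq. (3-34), Thm. 3-6 (pdf pp. 73, 96, 101–102 of the 2000 printing). [StreaterWightman1964]
* L. Hörmander, *The Analysis of Linear Partial Differential Operators I* (1990), Thm. 3.1.15. [HormanderALPDO1]
* K. Osterwalder, R. Schrader, Comm. Math. Phys. 31 (1973), §5 p. 97. [OsterwalderSchraderCMP1973]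

## Mathlib / tree

Used: `tendsto_integral_filter_of_dominated_convergence`, `generalized_tube_lemma`,
`HasCompactSupport.toSchwartzMap`, `Metric.isOpen_iff`, `ball_prod_same`; from the tree `localTube`,
`eq_zero_on_localTube_of_rayBoundaryValue_zero`, `continuous_mul_of_continuousAt_tsupport`
(`LocalTubeUniqueness`), `rayC`, `continuous_rayC`, `rayC_mem_forwardTube`, `isOpen_tubeCone`,
`smul_mem_tubeCone`, `HasDistributionalBoundaryValue.eq_integral_of_continuousOn`,
`apply_permTest_eq_of_isLocal`, `perm_mem_totallySpacelike`, `mem_totallySpacelike_of_complexifyPoint_mem`,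
`integral_comp_perm_spaceTime`, `integrable_ray_mul`.
-/

noncomputable section

open Filter Complex Set MeasureTheory
open _root_.Topology
open scoped SchwartzMap ContDiff

namespace Literature.MathematicalPhysics.QuantumLattice

variable {d n : ℕ}

/-! ### Ray limits at real points of continuity -/

/-- **Ray limits at real points of continuity** (dominated convergence): if `𝔊` is continuous on an
open set `U` containing the real configurations of the support of a continuous compactly supported
`φ`, then for every real direction `η` the integrals `∫ 𝔊(x + itη) φ(x) dx` are eventually
well defined as `t → 0⁺` and converge to `∫ 𝔊(x) φ(x) dx`. [folklore] -/
theorem tendsto_integral_rayC_mul_of_continuousOn {𝔊 : (Fin n → Fin (d + 1) → ℂ) → ℂ}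
    {U : Set (Fin n → Fin (d + 1) → ℂ)} (hU : IsOpen U) (h𝔊 : ContinuousOn 𝔊 U)
    (η : Fin n → SpaceTime d) {φ : (Fin n → SpaceTime d) → ℂ} (hφ : Continuous φ)
    (hφc : HasCompactSupport φ) (hφU : ∀ x ∈ tsupport φ, (fun k => complexifyPoint (x k)) ∈ U) :
    (∀ᶠ t : ℝ in 𝓝[>] 0, Integrable fun x => 𝔊 (rayC x η ((t : ℂ) * I)) * φ x) ∧
      Tendsto (fun t : ℝ => ∫ x, 𝔊 (rayC x η ((t : ℂ) * I)) * φ x) (𝓝[>] 0)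
        (𝓝 (∫ x, 𝔊 (fun k => complexifyPoint (x k)) * φ x)) := by
  set K := tsupport φ with hK
  have hKc : IsCompact K := hφc
  -- the ray map `(x, t) ↦ x + itη`
  set R : (Fin n → SpaceTime d) × ℝ → (Fin n → Fin (d + 1) → ℂ) := fun p => rayC p.1 η ((p.2 : ℂ) * I)
    with hR
  have hray : Continuous R :=
    (continuous_rayC η).comp (continuous_fst.prodMk ((continuous_ofReal.comp continuous_snd).mul
      continuous_const))
  have hR0 : ∀ x, R (x, 0) = fun k => complexifyPoint (x k) := fun x => by
    funext k; simp [hR, rayC_apply]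
  -- a uniform time `t₀` keeping the rays over `K` inside `U`
  obtain ⟨t₀, ht₀, hmem⟩ : ∃ t₀ > 0, ∀ x ∈ K, ∀ s ∈ Set.Icc (0 : ℝ) t₀, R (x, s) ∈ U := by
    have hW : IsOpen (R ⁻¹' U) := hU.preimage hray
    have hsub : K ×ˢ ({0} : Set ℝ) ⊆ R ⁻¹' U := by
      rintro ⟨x, s⟩ ⟨hx, hs⟩
      rw [Set.mem_singleton_iff] at hs
      subst hs
      show R (x, 0) ∈ U
      rw [hR0]
      exact hφU x hx
    obtain ⟨V, W, -, hW', hKV, h0W, hVW⟩ := generalized_tube_lemma hKc isCompact_singleton hW hsub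
    rw [Set.singleton_subset_iff] at h0W
    obtain ⟨ε, hε, hεW⟩ := Metric.isOpen_iff.1 hW' 0 h0W
    refine ⟨ε / 2, half_pos hε, fun x hx s hs => ?_⟩
    have hsW : s ∈ W := hεW (by
      rw [Metric.mem_ball, dist_zero_right, Real.norm_eq_abs, abs_of_nonneg hs.1]
      linarith [hs.2])
    exact hVW (Set.mk_mem_prod (hKV hx) hsW)
  -- a uniform bound on the compact image
  obtain ⟨C, hC⟩ : ∃ C, ∀ x ∈ K, ∀ s ∈ Set.Icc (0 : ℝ) t₀, ‖𝔊 (R (x, s))‖ ≤ C := by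
    have hcpt : IsCompact (R '' (K ×ˢ Set.Icc 0 t₀)) := (hKc.prod isCompact_Icc).image hray
    have hsubU : R '' (K ×ˢ Set.Icc 0 t₀) ⊆ U := by
      rintro _ ⟨⟨x, s⟩, ⟨hx, hs⟩, rfl⟩
      exact hmem x hx s hs
    obtain ⟨C, hC⟩ := hcpt.exists_bound_of_continuousOn (h𝔊.mono hsubU)
    exact ⟨C, fun x hx s hs => hC _ ⟨(x, s), ⟨hx, hs⟩, rfl⟩⟩
  have hIoc : ∀ᶠ s in 𝓝[>] (0 : ℝ), s ∈ Set.Ioc 0 t₀ := Ioc_mem_nhdsGT ht₀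
  -- off `K` the integrand vanishes
  have hzero : ∀ (s : ℝ) (x : Fin n → SpaceTime d), x ∉ K → 𝔊 (R (x, s)) * φ x = 0 := by
    intro s x hx
    rw [image_eq_zero_of_notMem_tsupport hx, mul_zero]
  -- continuity of the integrand for `0 ≤ s ≤ t₀`
  have hcont : ∀ s ∈ Set.Icc (0 : ℝ) t₀, Continuous fun x => 𝔊 (R (x, s)) * φ x := by
    intro s hs
    refine continuous_mul_of_continuousAt_tsupport (fun x hx => ?_) hφ
    have h1 : ContinuousAt 𝔊 (R (x, s)) := h𝔊.continuousAt (hU.mem_nhds (hmem x hx s hs))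
    have h2 : ContinuousAt (fun x => R (x, s)) x := (hray.comp (Continuous.prodMk_left s)).continuousAt
    exact ContinuousAt.comp (g := 𝔊) (f := fun x => R (x, s)) h1 h2
  refine ⟨?_, ?_⟩
  · filter_upwards [hIoc] with s hs
    exact (hcont s ⟨hs.1.le, hs.2⟩).integrable_of_hasCompactSupport hφc.mul_left
  refine tendsto_integral_filter_of_dominated_convergence (fun x => C * ‖φ x‖) ?_ ?_ ?_ ?_
  · filter_upwards [hIoc] with s hs
    exact (hcont s ⟨hs.1.le, hs.2⟩).aestronglyMeasurable
  · filter_upwards [hIoc] with s hs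
    refine Eventually.of_forall fun x => ?_
    by_cases hx : x ∈ K
    · rw [norm_mul]
      exact mul_le_mul_of_nonneg_right (hC x hx s ⟨hs.1.le, hs.2⟩) (norm_nonneg _)
    · show ‖𝔊 (R (x, s)) * φ x‖ ≤ C * ‖φ x‖
      rw [hzero s x hx, norm_zero, image_eq_zero_of_notMem_tsupport hx, norm_zero, mul_zero]
  · exact (hφ.integrable_of_hasCompactSupport hφc).norm.const_mul C
  · refine Eventually.of_forall fun x => ?_
    by_cases hx : x ∈ K
    · have h1 : ContinuousAt 𝔊 (fun k => complexifyPoint (x k)) :=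
        h𝔊.continuousAt (hU.mem_nhds (hφU x hx))
      have h2 : Tendsto (fun s : ℝ => R (x, s)) (𝓝 0) (𝓝 (fun k => complexifyPoint (x k))) := by
        have h3 : Continuous fun s : ℝ => R (x, s) := hray.comp (Continuous.prodMk_right x)
        have := h3.tendsto 0
        rwa [hR0] at this
      exact ((h1.tendsto.comp h2).mono_left nhdsWithin_le_nhds).mul tendsto_const_nhds
    · have : (fun s : ℝ => 𝔊 (R (x, s)) * φ x) = fun _ => 0 := funext fun s => hzero s x hx
      show Tendsto (fun s : ℝ => 𝔊 (R (x, s)) * φ x) (𝓝[>] 0) (𝓝 (𝔊 (fun k => complexifyPoint (x k)) * φ x))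
      rw [this, image_eq_zero_of_notMem_tsupport hx, mul_zero]
      exact tendsto_const_nhds

/-! ### The one-sided anchor -/

section Anchor

variable {𝔚 : (Fin n → Fin (d + 1) → ℂ) → ℂ} {T : 𝓢((Fin n → SpaceTime d), ℂ) →L[ℂ] ℂ}

/-- **`W_σ = W` on the forward tube next to a one-sided Jost point.** Let `𝔚` be analytic on the
extended tube `𝒯'ₙ` with distributional boundary value `T` from `𝒯ₙ`, `T` a local distribution
(Streater–Wightman (3-34) on compactly supported test functions). If the permuted real configuration
`x ∘ σ` lies in `𝒯'ₙ` (a Jost point — nothing is assumed about `x` itself), then `𝔚(z ∘ σ) = 𝔚(z)`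
for all `z ∈ 𝒯ₙ` in a neighbourhood of `x`: on a local tube over a ball around `x` the holomorphic
function `𝔚 − 𝔚(· ∘ σ)` has vanishing ray boundary values — `𝔚 → T`, and
`𝔚((· + itη) ∘ σ) → 𝔚(· ∘ σ) = T(· ∘ σ⁻¹) = T` by continuity at the Jost points, the coincidence of
`T` with `𝔚` there, and local commutativity — so it vanishes (S–W Thm. 2-17 / Hörmander
Thm. 3.1.15 on a local tube). The one-sided form of S–W Thm. 3-6 ("`W` and `W_π` continue one
another"). [cite: StreaterWightman1964, Thm 3-6] -/
theorem perm_eq_near_of_perm_real_mem (h𝔚 : AnalyticOnNhd ℂ 𝔚 (relExtendedTube d n))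
    (hbv : HasDistributionalBoundaryValue 𝔚 T)
    (hloc : ∀ (a b : Fin n), (a : ℕ) + 1 = b → ∀ F : 𝓢((Fin n → SpaceTime d), ℂ),
      HasCompactSupport (F : (Fin n → SpaceTime d) → ℂ) →
      tsupport (F : (Fin n → SpaceTime d) → ℂ) ⊆ {x | IsSpacelike (x a - x b)} →
      T (permTest (Equiv.swap a b) F) = T F)
    (σ : Equiv.Perm (Fin n)) {x : Fin n → SpaceTime d}
    (hxσ : (fun k => complexifyPoint (x (σ k))) ∈ relExtendedTube d n) :
    ∃ U ∈ 𝓝 (fun k => complexifyPoint (x k)),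
      ∀ z ∈ U, z ∈ forwardTube d n → 𝔚 (fun k => z (σ k)) = 𝔚 z := by
  -- the open set where `z ∘ σ ∈ 𝒯'ₙ`
  set V : Set (Fin n → Fin (d + 1) → ℂ) := (permConfig d n σ) ⁻¹' relExtendedTube d n with hV
  have hVo : IsOpen V := isOpen_relExtendedTube.preimage (permConfig d n σ).continuous
  have hxV : (fun k => complexifyPoint (x k)) ∈ V := hxσ
  -- a product ball around `(x, 0)` whose points `x' + iy` lie in `V`
  set Φ : (Fin n → SpaceTime d) × (Fin n → SpaceTime d) → (Fin n → Fin (d + 1) → ℂ) :=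
    fun p => rayC p.1 p.2 I with hΦ
  have hΦc : Continuous Φ := by
    simp only [hΦ, rayC]
    exact (continuous_cpxConfig.comp continuous_fst).add
      ((continuous_cpxConfig.comp continuous_snd).const_smul I)
  have hc0 : complexifyPoint (0 : SpaceTime d) = 0 := by funext μ; simp
  have hΦx : Φ (x, 0) = fun k => complexifyPoint (x k) := by
    funext k; simp [hΦ, rayC_apply, hc0]
  obtain ⟨r, hr, hball⟩ : ∃ r > 0, Metric.ball x r ×ˢ Metric.ball (0 : Fin n → SpaceTime d) r ⊆ Φ ⁻¹' V := by
    have ho : IsOpen (Φ ⁻¹' V) := hVo.preimage hΦc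
    have hm : (x, (0 : Fin n → SpaceTime d)) ∈ Φ ⁻¹' V := by
      show Φ (x, 0) ∈ V
      rw [hΦx]; exact hxV
    obtain ⟨r, hr, hsub⟩ := Metric.isOpen_iff.1 ho _ hm
    exact ⟨r, hr, by rw [ball_prod_same]; exact hsub⟩
  have hΦV : ∀ x' y : Fin n → SpaceTime d, x' ∈ Metric.ball x r → ‖y‖ < r → rayC x' y I ∈ V := by
    intro x' y hx' hy
    have : (x', y) ∈ Metric.ball x r ×ˢ Metric.ball (0 : Fin n → SpaceTime d) r :=
      ⟨hx', by rwa [Metric.mem_ball, dist_zero_right]⟩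
    exact hball this
  -- the local tube over the ball
  set X : Set (Fin n → SpaceTime d) := Metric.ball x r with hX
  set Γ : Set (Fin n → SpaceTime d) := tubeCone d n with hΓ
  have hXo : IsOpen X := Metric.isOpen_ball
  have hXc : Convex ℝ X := convex_ball x r
  have hΓo : IsOpen Γ := isOpen_tubeCone
  have hΓc : Convex ℝ Γ := by
    intro y hy y' hy' a b ha hb hab k
    have h := QuantumFieldTheory.convex_forwardCone (d := d) (hy k) (hy' k) ha hb hab
    simpa [QuantumFieldTheory.succDiff_add, QuantumFieldTheory.succDiff_smul] using h
  have hΓcone : ∀ c : ℝ, 0 < c → ∀ y ∈ Γ, c • y ∈ Γ := fun c hc y hy => smul_mem_tubeCone hy hc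
  -- points of the local tube: in `𝒯ₙ` and in `V`
  have hLT : ∀ z ∈ localTube X Γ r, z ∈ forwardTube d n := by
    intro z hz
    rw [← rayC_reConfigCLM_imConfigCLM z]
    exact rayC_mem_forwardTube _ hz.2.1 (by simp)
  have hLV : ∀ z ∈ localTube X Γ r, z ∈ V := by
    intro z hz
    rw [← rayC_reConfigCLM_imConfigCLM z]
    exact hΦV _ _ hz.1 hz.2.2
  have hTsub : forwardTube d n ⊆ relExtendedTube d n :=
    QuantumFieldTheory.forwardTube_subset_relForwardTube.trans relForwardTube_subset_relExtendedTube
  -- the difference `D = 𝔚 − 𝔚(· ∘ σ)` is holomorphic on the local tube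
  set D : (Fin n → Fin (d + 1) → ℂ) → ℂ := fun z => 𝔚 z - 𝔚 (fun k => z (σ k)) with hD
  have hDd : DifferentiableOn ℂ D (localTube X Γ r) := by
    intro z hz
    have h1 : DifferentiableAt ℂ 𝔚 z := (h𝔚 z (hTsub (hLT z hz))).differentiableAt
    have h2 : DifferentiableAt ℂ (fun z : Fin n → Fin (d + 1) → ℂ => 𝔚 (fun k => z (σ k))) z :=
      ((h𝔚 _ (hLV z hz)).comp (analyticAt_permConfig σ z)).differentiableAt
    exact (h1.sub h2).differentiableWithinAt
  -- continuity of `𝔚(· ∘ σ)` on `V`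
  have h𝔚c : ContinuousOn 𝔚 (relExtendedTube d n) := h𝔚.continuousOn
  have h𝔚σc : ContinuousOn (fun z : Fin n → Fin (d + 1) → ℂ => 𝔚 (fun k => z (σ k))) V :=
    h𝔚c.comp (permConfig d n σ).continuous.continuousOn fun z hz => hz
  -- real points of `X`: `x'` in `V`, `x' ∘ σ` a Jost point, `x'` totally space-like
  have hXV : ∀ x' ∈ X, (fun k => complexifyPoint (x' k)) ∈ V := by
    intro x' hx'
    have h := hΦV x' 0 hx' (by simpa using hr)
    have h0 : rayC x' 0 I = fun k => complexifyPoint (x' k) := by funext k; simp [rayC_apply, hc0]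
    rwa [h0] at h
  have hXts : X ⊆ totallySpacelike d n := by
    intro x' hx'
    have h1 : (fun k => x' (σ k)) ∈ totallySpacelike d n :=
      mem_totallySpacelike_of_complexifyPoint_mem (hXV x' hx')
    have := perm_mem_totallySpacelike h1 σ.symm
    simpa using this
  -- the ray boundary values of `D` vanish
  have hlim : ∀ η ∈ Γ, ∀ φ : (Fin n → SpaceTime d) → ℂ, ContDiff ℝ ∞ φ → HasCompactSupport φ →
      tsupport φ ⊆ X →
      Tendsto (fun t : ℝ => ∫ x', D (rayC x' η ((t : ℂ) * I)) * φ x') (𝓝[>] 0) (𝓝 0) := by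
    intro η hη φ hφ hφc hφX
    set G : 𝓢((Fin n → SpaceTime d), ℂ) := hφc.toSchwartzMap hφ with hG
    have hGapply : ∀ y, G y = φ y := fun y => rfl
    have hGc : HasCompactSupport (G : (Fin n → SpaceTime d) → ℂ) := hφc
    have hGX : tsupport (G : (Fin n → SpaceTime d) → ℂ) ⊆ X := hφX
    -- (i) `∫ 𝔚(x' + itη) φ → T φ`
    have h1 : Tendsto (fun t : ℝ => ∫ x', 𝔚 (rayC x' η ((t : ℂ) * I)) * φ x') (𝓝[>] 0) (𝓝 (T G)) :=
      hbv η hη G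
    -- (ii) `∫ 𝔚((x' + itη) ∘ σ) φ → ∫ 𝔚(x' ∘ σ) φ`
    have h2 := tendsto_integral_rayC_mul_of_continuousOn hVo h𝔚σc η hφ.continuous hφc
      fun x' hx' => hXV x' (hφX hx')
    -- (iii) `T φ = ∫ 𝔚(x' ∘ σ) φ(x') dx'`
    have h3 : T G = ∫ x', 𝔚 (fun k => complexifyPoint (x' (σ k))) * φ x' := by
      have h3a : T (permTest σ⁻¹ G) = ∫ y, 𝔚 (fun k => complexifyPoint (y k)) * (permTest σ⁻¹ G) y := by
        refine hbv.eq_integral_of_continuousOn isOpen_relExtendedTube h𝔚c _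
          (hasCompactSupport_permTest hGc σ⁻¹) fun y hy => ?_
        rw [tsupport_permTest] at hy
        have hy' : (fun k => y (σ⁻¹ k)) ∈ X := hGX hy
        have h := hXV _ hy'
        have key : permConfig d n σ (fun k => complexifyPoint (y (σ⁻¹ k))) = fun k => complexifyPoint (y k) := by
          funext i; simp
        change permConfig d n σ _ ∈ relExtendedTube d n at h
        rwa [key] at h
      have h3b : T (permTest σ⁻¹ G) = T G := apply_permTest_eq_of_isLocal hloc σ⁻¹ G hGc (hGX.trans hXts)
      rw [← h3b, h3a, ← integral_comp_perm_spaceTime σ]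
      refine integral_congr_ae (Eventually.of_forall fun y => ?_)
      simp only [permTest_apply, Equiv.Perm.coe_inv, Function.comp_def, Equiv.apply_symm_apply, hGapply]
    -- integrability of the first integrand for `t > 0`
    have h𝔚T : DifferentiableOn ℂ 𝔚 (forwardTube d n) := (h𝔚.mono hTsub).differentiableOn
    have hI1 : ∀ᶠ t : ℝ in 𝓝[>] 0, Integrable fun x' => 𝔚 (rayC x' η ((t : ℂ) * I)) * φ x' := by
      filter_upwards [self_mem_nhdsWithin] with t ht
      exact integrable_ray_mul h𝔚T hη ht hGc
    have hsub : (fun t : ℝ => ∫ x', D (rayC x' η ((t : ℂ) * I)) * φ x') =ᶠ[𝓝[>] 0]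
        fun t => (∫ x', 𝔚 (rayC x' η ((t : ℂ) * I)) * φ x') -
          ∫ x', 𝔚 (fun k => rayC x' η ((t : ℂ) * I) (σ k)) * φ x' := by
      filter_upwards [hI1, h2.1] with t ht1 ht2
      rw [← integral_sub ht1 ht2]
      refine integral_congr_ae (Eventually.of_forall fun x' => ?_)
      simp only [hD, sub_mul]
    rw [tendsto_congr' hsub, ← sub_self (T G)]
    refine h1.sub ?_
    rw [h3]
    exact h2.2
  -- hence `D = 0` on the local tube
  have hDzero : ∀ z ∈ localTube X Γ r, D z = 0 := fun z hz =>
    eq_zero_on_localTube_of_rayBoundaryValue_zero hXo hXc hΓo hΓc hΓcone hDd hlim hz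
  -- the neighbourhood `U = {Re z ∈ X, ‖Im z‖ < r}`
  refine ⟨{z | reConfigCLM d n z ∈ X ∧ ‖imConfigCLM d n z‖ < r}, ?_, ?_⟩
  · refine IsOpen.mem_nhds ?_ ⟨?_, ?_⟩
    · exact (hXo.preimage (reConfigCLM d n).continuous).inter
        (isOpen_Iio.preimage (continuous_norm.comp (imConfigCLM d n).continuous))
    · show reConfigCLM d n (fun k => complexifyPoint (x k)) ∈ X
      have : reConfigCLM d n (fun k => complexifyPoint (x k)) = x := by
        rw [reConfigCLM_apply]; funext k; exact rePart_complexifyPoint (x k)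
      rw [this]
      exact Metric.mem_ball_self hr
    · show ‖imConfigCLM d n (fun k => complexifyPoint (x k))‖ < r
      have : imConfigCLM d n (fun k => complexifyPoint (x k)) = 0 := by
        rw [imConfigCLM_apply]; funext k; exact imPart_complexifyPoint (x k)
      rw [this, norm_zero]
      exact hr
  · rintro z ⟨hzX, hzr⟩ hzT
    have hzΓ : imConfigCLM d n z ∈ Γ := by
      rw [imConfigCLM_apply]
      exact (mem_forwardTube_iff_imPart_mem_tubeCone z).1 hzT
    have := hDzero z ⟨hzX, hzΓ, hzr⟩
    exact (sub_eq_zero.1 this).symm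

end Anchor

end Literature.MathematicalPhysics.QuantumLattice
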